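import Mathlib
import Literature.AlgebraicGeometry.Tropical.TorusCycles
import Summits.HodgeConjecture.HodgeConjecture.Theorems.TropicalWeilObstructionTropicalWeilVanishingGenericSection
import HarnessLib

/-!
# Crux `TropicalWeilVanishing` (stmt-HodgeConjecture-18478) — tie structures at a very general Weil
# period are UNIVERSALLY PERSISTENT (the kernel form of the excess-census filter)

Route `TropicalWeilObstruction` of `HodgeConjecture`; cell `pub-hodge-tropical` (Hodge NEGATION SINK,
Kontsevich's tropical test — scoped exploration, no summit claim). HONEST FRAMING: this file is the
linear algebra behind a SEARCH FILTER (K1-SCOPE §6.1 / §8b, HOME `PILOT-6.1.md` §E13–E14 and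
`certificates/splitgerms/README` §1, §7); it decides nothing about K1 (`TropicalWeilVanishing`, OPEN),
nothing about K1_∂, and nothing here bears on the Hodge conjecture.

Setting. A second-order tropical theta divisor of `X_Q = ℝᵍ/Qℤᵍ` is the corner locus of the distance
to a coset `½c + ℤᵍ` in the metric `Q`; a point `y` lies on it where two coset points `p ≠ p'` are
`Q`-equidistant from `y` ("tied"). For symmetric `Q` the tie is ONE equation, LINEAR in `Q` and in `y`:
`‖y − p‖²_Q − ‖y − p'‖²_Q = 2 dᵀQ(y − m)` with `d = p' − p ∈ ℤᵍ` and `m = (p + p')/2` the midpoint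
(`normSq_sub_normSq_eq_two_mul`). An EXCESS cell of the arrangement of several divisors is one on
which the tie differences `d_j` are linearly dependent; every relation `Σ_j ε_j d_j = 0` then forces
the number `Ψ_ε(Q) := Σ_j ε_j d_jᵀ Q m_j` to vanish (`relForm_eq_zero_of_ties`), and since `Ψ_ε` is
linear in `Q`, a tie structure realised at two periods `Q` and `Q + tD`, `t ≠ 0`, has `Ψ_ε(D) = 0`
(`relForm_eq_zero_of_ties_of_ties_add_smul`) — the PERSISTENCE CRITERION of tropical-1 gen 12
(necessity half), derived independently for the product locus by tropical-2 gen 11 (E14 (1)).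

Main statement (`relForm_eq_zero_of_isWeilGeneric`). If the coset data are RATIONAL (`d_j, m_j ∈ ℚᵍ`,
as they are for theta divisors: `d_j ∈ ℤ²ⁿ`, `4m_j ∈ ℤ²ⁿ`) and the structure is realised by some
point `y` at a VERY GENERAL Weil period `Q` (positive definite, `QJ = JQ`, `IsWeilGeneric n Q`), then
for every rational relation `ε` among the `d_j` the form `Ψ_ε` vanishes at EVERY symmetric
`J`-commuting matrix `P` — because `Ψ_ε(Q) = 0` is a rational linear relation among the entries of `Q`
and such relations hold on the whole Weil period domain (`weilGeneric_linear_forms`, tree). Corollary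
(`sum_smul_tie_eq_zero_of_isWeilGeneric`): at every `P ∈ Sym_J` and every point `y'` the tie
functionals satisfy the same relation, `Σ_j ε_j · dⱼᵀP(y' − m_j) = 0` — the structure is formally
consistent at every period of the family, in particular at the split point `B = 0` and on the
product locus, for EVERY direction of approach. This is why a census of excess types that can occur
on a very general tropical Weil torus may discard every tied set having a relation with
`Ψ_ε|Sym_J ≢ 0`, independently of the degeneration used to find candidates.

Mathlib + the tree lemma `TropicalWeilVanishing.weilGeneric_linear_forms`; no definition, no named
fact, no sorry. negation-sink work.

## References

* [Zharkov2020TropicalWeil] I. Zharkov, Tropical abelian varieties, Weil classes and the Hodge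
  conjecture, arXiv:2002.02347 (2020), §2 (pp. 2–4) (the Weil family, very general members).
* [MikhalkinZharkov2014Eigenwave] G. Mikhalkin, I. Zharkov, Tropical eigenwave and intermediate
  Jacobians, LN UMI 15 (2014), §5 (tropical theta functions and their corner loci).
-/

-- `Summit.HodgeConjecture.HodgeConjecture.…` is the mandated namespace (single-conjunct summit).
set_option linter.dupNamespace false

noncomputable section

open scoped BigOperators Matrix
open Matrix Literature.AlgebraicGeometry.Tropical

namespace Summit.HodgeConjecture.HodgeConjecture.Theorems.TropicalWeilVanishing.GenericTies

/-! ### The tie equation: linear in the period and in the point -/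

section AnyPeriod

variable {g : ℕ}

/-- **The tie equation is linear.** For a symmetric `Q`,
`‖y − p‖²_Q − ‖y − p'‖²_Q = 2 (p' − p)ᵀ Q (y − (p + p')/2)`. [folklore] -/
theorem normSq_sub_normSq_eq_two_mul (Q : Matrix (Fin g) (Fin g) ℝ) (hQ : Qᵀ = Q)
    (y p p' : Fin g → ℝ) :
    (y - p) ⬝ᵥ Q *ᵥ (y - p) - (y - p') ⬝ᵥ Q *ᵥ (y - p') =
      2 * ((p' - p) ⬝ᵥ Q *ᵥ (y - (1 / 2 : ℝ) • (p + p'))) := by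
  have hsym : ∀ u v : Fin g → ℝ, u ⬝ᵥ Q *ᵥ v = v ⬝ᵥ Q *ᵥ u := fun u v => by
    rw [Matrix.dotProduct_mulVec, ← Matrix.mulVec_transpose, hQ, dotProduct_comm]
  have e1 : (y - p) ⬝ᵥ Q *ᵥ (y - p) = y ⬝ᵥ Q *ᵥ y - 2 * (p ⬝ᵥ Q *ᵥ y) + p ⬝ᵥ Q *ᵥ p := by
    simp only [sub_dotProduct, dotProduct_sub, Matrix.mulVec_sub]
    rw [hsym y p]; ring
  have e2 : (y - p') ⬝ᵥ Q *ᵥ (y - p') = y ⬝ᵥ Q *ᵥ y - 2 * (p' ⬝ᵥ Q *ᵥ y) + p' ⬝ᵥ Q *ᵥ p' := by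
    simp only [sub_dotProduct, dotProduct_sub, Matrix.mulVec_sub]
    rw [hsym y p']; ring
  have e3 : (p' - p) ⬝ᵥ Q *ᵥ (y - (1 / 2 : ℝ) • (p + p')) =
      p' ⬝ᵥ Q *ᵥ y - p ⬝ᵥ Q *ᵥ y - (1 / 2) * (p' ⬝ᵥ Q *ᵥ p' - p ⬝ᵥ Q *ᵥ p) := by
    simp only [sub_dotProduct, dotProduct_sub, Matrix.mulVec_sub, Matrix.mulVec_smul, dotProduct_smul,
      Matrix.mulVec_add, dotProduct_add, smul_eq_mul]
    rw [hsym p p']; ring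
  rw [e1, e2, e3]; ring

/-- **Ties are the zeros of a linear functional.** `y` is `Q`-equidistant from `p` and `p'` iff
`(p' − p)ᵀ Q (y − m) = 0`, `m` the midpoint (symmetric `Q`). [folklore] -/
theorem normSq_eq_normSq_iff (Q : Matrix (Fin g) (Fin g) ℝ) (hQ : Qᵀ = Q) (y p p' : Fin g → ℝ) :
    (y - p) ⬝ᵥ Q *ᵥ (y - p) = (y - p') ⬝ᵥ Q *ᵥ (y - p') ↔
      (p' - p) ⬝ᵥ Q *ᵥ (y - (1 / 2 : ℝ) • (p + p')) = 0 := by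
  have h := normSq_sub_normSq_eq_two_mul Q hQ y p p'
  constructor
  · intro e; have : (2 : ℝ) * ((p' - p) ⬝ᵥ Q *ᵥ (y - (1 / 2 : ℝ) • (p + p'))) = 0 := by
      rw [← h, e, sub_self]
    linarith
  · intro e; rw [e, mul_zero] at h; linarith

variable {k : ℕ}

/-- **A relation among the tie differences evaluates the midpoints.** For ANY matrix `M`, any point
`y`, differences `d_j`, midpoints `m_j` and coefficients `ε_j` with `Σ_j ε_j d_j = 0`:
`Σ_j ε_j · d_jᵀ M (y − m_j) = − Σ_j ε_j · d_jᵀ M m_j` — the `y`-terms cancel. [folklore] -/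
theorem sum_smul_tie_eq_neg_relForm (M : Matrix (Fin g) (Fin g) ℝ) (d m : Fin k → Fin g → ℝ)
    (ε : Fin k → ℝ) (hrel : ∑ j, ε j • d j = 0) (y : Fin g → ℝ) :
    ∑ j, ε j * (d j ⬝ᵥ M *ᵥ (y - m j)) = -∑ j, ε j * (d j ⬝ᵥ M *ᵥ m j) := by
  have hy : ∑ j, ε j * (d j ⬝ᵥ M *ᵥ y) = 0 := by
    have : ∑ j, ε j * (d j ⬝ᵥ M *ᵥ y) = (∑ j, ε j • d j) ⬝ᵥ M *ᵥ y := by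
      rw [sum_dotProduct]
      exact Finset.sum_congr rfl fun j _ => by rw [smul_dotProduct, smul_eq_mul]
    rw [this, hrel, zero_dotProduct]
  simp only [Matrix.mulVec_sub, dotProduct_sub, mul_sub, Finset.sum_sub_distrib, hy, zero_sub]

/-- **Necessity at any period (the relation form vanishes where the structure is realised).** If at
the matrix `M` some point `y` is tied for every `j` (`d_jᵀ M (y − m_j) = 0`), then every relation
`Σ_j ε_j d_j = 0` gives `Ψ_ε(M) := Σ_j ε_j d_jᵀ M m_j = 0`. [folklore] -/
theorem relForm_eq_zero_of_ties (M : Matrix (Fin g) (Fin g) ℝ) (d m : Fin k → Fin g → ℝ)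
    (ε : Fin k → ℝ) (hrel : ∑ j, ε j • d j = 0) (y : Fin g → ℝ)
    (htie : ∀ j, d j ⬝ᵥ M *ᵥ (y - m j) = 0) :
    ∑ j, ε j * (d j ⬝ᵥ M *ᵥ m j) = 0 := by
  have h := sum_smul_tie_eq_neg_relForm M d m ε hrel y
  simp only [htie, mul_zero, Finset.sum_const_zero] at h
  linarith

/-- **The persistence criterion, necessity half (tropical-1 gen 12, README §1; E14 (1)).** `Ψ_ε` is
linear in the matrix, so a tie structure with a relation `ε` that is realised at `M` (by `y`) and at
`M + t·D` (by `y'`) with `t ≠ 0` has `Ψ_ε(D) = Σ_j ε_j d_jᵀ D m_j = 0`: an excess cell keeps its tied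
set along the direction `D` only if every relation kills `D`. [folklore] -/
theorem relForm_eq_zero_of_ties_of_ties_add_smul (M D : Matrix (Fin g) (Fin g) ℝ)
    (d m : Fin k → Fin g → ℝ) (ε : Fin k → ℝ) (hrel : ∑ j, ε j • d j = 0) {t : ℝ} (ht : t ≠ 0)
    (y y' : Fin g → ℝ) (htie : ∀ j, d j ⬝ᵥ M *ᵥ (y - m j) = 0)
    (htie' : ∀ j, d j ⬝ᵥ (M + t • D) *ᵥ (y' - m j) = 0) :
    ∑ j, ε j * (d j ⬝ᵥ D *ᵥ m j) = 0 := by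
  have h0 := relForm_eq_zero_of_ties M d m ε hrel y htie
  have h1 := relForm_eq_zero_of_ties (M + t • D) d m ε hrel y' htie'
  have hsplit : ∑ j, ε j * (d j ⬝ᵥ (M + t • D) *ᵥ m j) =
      ∑ j, ε j * (d j ⬝ᵥ M *ᵥ m j) + t * ∑ j, ε j * (d j ⬝ᵥ D *ᵥ m j) := by
    rw [Finset.mul_sum, ← Finset.sum_add_distrib]
    refine Finset.sum_congr rfl fun j _ => ?_
    rw [Matrix.add_mulVec, Matrix.smul_mulVec, dotProduct_add, dotProduct_smul, smul_eq_mul]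
    ring
  rw [hsplit, h0, zero_add] at h1
  rcases mul_eq_zero.mp h1 with h | h
  · exact absurd h ht
  · exact h

/-- `Ψ_ε(M)` as a linear form in the ENTRIES of `M` with coefficients `Σ_j ε_j d_{j,a} m_{j,b}`.
[folklore] -/
theorem relForm_eq_sum_entries (M : Matrix (Fin g) (Fin g) ℝ) (d m : Fin k → Fin g → ℝ)
    (ε : Fin k → ℝ) :
    ∑ j, ε j * (d j ⬝ᵥ M *ᵥ m j) =
      ∑ ab : Fin g × Fin g, (∑ j, ε j * d j ab.1 * m j ab.2) * M ab.1 ab.2 := by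
  have step : ∀ j, ε j * (d j ⬝ᵥ M *ᵥ m j) =
      ∑ ab : Fin g × Fin g, ε j * d j ab.1 * m j ab.2 * M ab.1 ab.2 := by
    intro j
    rw [dotProduct, Finset.mul_sum, Fintype.sum_prod_type]
    refine Finset.sum_congr rfl fun a _ => ?_
    rw [Matrix.mulVec, dotProduct, Finset.mul_sum, Finset.mul_sum]
    refine Finset.sum_congr rfl fun b _ => ?_
    ring
  simp_rw [step]
  rw [Finset.sum_comm]
  refine Finset.sum_congr rfl fun ab _ => ?_
  rw [Finset.sum_mul]

end AnyPeriod

/-! ### At a very general Weil period every relation form vanishes on the whole period domain -/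

section Weil

variable {n k : ℕ}

/-- **Universal persistence of generic tie structures.** Let `Q` be a very general Weil period
(`Q` positive definite, `QJ = JQ`, free coordinates algebraically independent over `ℚ`). If a tie
structure with RATIONAL differences `d_j` and midpoints `m_j` is realised at `Q` by some point `y`,
then for every rational relation `Σ_j ε_j d_j = 0` the form `Ψ_ε(P) = Σ_j ε_j d_jᵀ P m_j` vanishes at
EVERY symmetric `J`-commuting `P` (not only at `Q` and not only along one direction): the structure's
relations are persistent in all `n²` directions of the family. Mechanism: `Ψ_ε(Q) = 0` is a rational
linear relation among the entries of `Q` (`relForm_eq_zero_of_ties`, `relForm_eq_sum_entries`), and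
such relations hold identically on the Weil period domain (`weilGeneric_linear_forms`).
[cite: Zharkov2020TropicalWeil, §2 (pp. 2–4)] -/
theorem relForm_eq_zero_of_isWeilGeneric {Q : Matrix (Fin (2 * n)) (Fin (2 * n)) ℝ}
    (hQ : Q.PosDef) (hQJ : Q * weilJ n = weilJ n * Q) (hgen : IsWeilGeneric n Q)
    (d m : Fin k → Fin (2 * n) → ℚ) (ε : Fin k → ℚ) (hrel : ∑ j, ε j • d j = 0)
    (y : Fin (2 * n) → ℝ)
    (htie : ∀ j, (fun a => (d j a : ℝ)) ⬝ᵥ Q *ᵥ (y - fun a => (m j a : ℝ)) = 0)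
    (P : Matrix (Fin (2 * n)) (Fin (2 * n)) ℝ) (hS : P.IsSymm) (hJ : P * weilJ n = weilJ n * P) :
    ∑ j, (ε j : ℝ) * ((fun a => (d j a : ℝ)) ⬝ᵥ P *ᵥ fun a => (m j a : ℝ)) = 0 := by
  -- real casts of the data
  set dR : Fin k → Fin (2 * n) → ℝ := fun j a => (d j a : ℝ) with hdR
  set mR : Fin k → Fin (2 * n) → ℝ := fun j a => (m j a : ℝ) with hmR
  set εR : Fin k → ℝ := fun j => (ε j : ℝ) with hεR
  have hrelR : ∑ j, εR j • dR j = 0 := by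
    funext a
    have h := congrFun hrel a
    simp only [Finset.sum_apply, Pi.smul_apply, smul_eq_mul, Pi.zero_apply] at h ⊢
    have : ((∑ j, ε j * d j a : ℚ) : ℝ) = 0 := by rw [h]; simp
    push_cast at this
    simpa [hεR, hdR] using this
  -- the rational coefficients of `Ψ_ε` as a form in the matrix entries
  let c : Fin (2 * n) × Fin (2 * n) → ℚ := fun ab => ∑ j, ε j * d j ab.1 * m j ab.2
  have hc_cast : ∀ ab : Fin (2 * n) × Fin (2 * n),
      (c ab : ℝ) = ∑ j, εR j * dR j ab.1 * mR j ab.2 := by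
    intro ab; push_cast [c, hεR, hdR, hmR]; rfl
  have form_eq : ∀ M : Matrix (Fin (2 * n)) (Fin (2 * n)) ℝ,
      ∑ ab, (c ab : ℝ) * M ab.1 ab.2 = ∑ j, εR j * (dR j ⬝ᵥ M *ᵥ mR j) := by
    intro M
    rw [relForm_eq_sum_entries M dR mR εR]
    exact Finset.sum_congr rfl fun ab _ => by rw [hc_cast]
  -- at `Q` the form vanishes because the structure is realised there
  have hQ0 : ∑ ab, (c ab : ℝ) * Q ab.1 ab.2 = 0 := by
    rw [form_eq Q]
    exact relForm_eq_zero_of_ties Q dR mR εR hrelR y htie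
  -- hence at every `P ∈ Sym_J`
  have hP := weilGeneric_linear_forms hQ hQJ hgen c hQ0 P hS hJ
  rw [form_eq P] at hP
  exact hP

/-- **Corollary: the tie functionals satisfy the same relation at every period of the family.** Under
the hypotheses of `relForm_eq_zero_of_isWeilGeneric`, for every symmetric `J`-commuting `P` and every
point `y'`: `Σ_j ε_j · d_jᵀ P (y' − m_j) = 0`. So the `k` tie equations of a structure that occurs on a
very general tropical Weil torus are linearly dependent in the same way at every period `P ∈ Sym_J`
(formal consistency of the excess structure everywhere on the family, in particular at the split
point `B = 0` and on the product locus, from every direction of approach) — the filter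
"`Ψ_ε|Sym_J ≡ 0` for all relations" used by the excess censuses (HOME `PILOT-6.1.md` §E13/E14,
`certificates/splitgerms/README` §7) discards no type that can occur generically.
[cite: Zharkov2020TropicalWeil, §2 (pp. 2–4)] -/
theorem sum_smul_tie_eq_zero_of_isWeilGeneric {Q : Matrix (Fin (2 * n)) (Fin (2 * n)) ℝ}
    (hQ : Q.PosDef) (hQJ : Q * weilJ n = weilJ n * Q) (hgen : IsWeilGeneric n Q)
    (d m : Fin k → Fin (2 * n) → ℚ) (ε : Fin k → ℚ) (hrel : ∑ j, ε j • d j = 0)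
    (y : Fin (2 * n) → ℝ)
    (htie : ∀ j, (fun a => (d j a : ℝ)) ⬝ᵥ Q *ᵥ (y - fun a => (m j a : ℝ)) = 0)
    (P : Matrix (Fin (2 * n)) (Fin (2 * n)) ℝ) (hS : P.IsSymm) (hJ : P * weilJ n = weilJ n * P)
    (y' : Fin (2 * n) → ℝ) :
    ∑ j, (ε j : ℝ) * ((fun a => (d j a : ℝ)) ⬝ᵥ P *ᵥ (y' - fun a => (m j a : ℝ))) = 0 := by
  have hrelR : ∑ j, (ε j : ℝ) • (fun a => (d j a : ℝ)) = 0 := by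
    funext a
    have h := congrFun hrel a
    simp only [Finset.sum_apply, Pi.smul_apply, smul_eq_mul, Pi.zero_apply] at h ⊢
    have : ((∑ j, ε j * d j a : ℚ) : ℝ) = 0 := by rw [h]; simp
    push_cast at this
    exact this
  rw [sum_smul_tie_eq_neg_relForm P (fun j a => (d j a : ℝ)) (fun j a => (m j a : ℝ)) (fun j => (ε j : ℝ))
    hrelR y']
  rw [relForm_eq_zero_of_isWeilGeneric hQ hQJ hgen d m ε hrel y htie P hS hJ, neg_zero]

end Weil

/-! ### The converse (appended): vanishing relation forms at `M` ⟹ the ties are solvable at `M`;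
so the criterion is an `iff` at every non-degenerate matrix, and a structure occurring on a very general
Weil torus is FORMALLY realisable (tie equations solvable; nearest-point inequalities not asserted) at
every positive definite period of the family, e.g. at the split point `B = 0` or a product period. -/

section Converse

variable {g k : ℕ}

/-- **The persistence criterion, sufficiency half.** If `det M ≠ 0` and every relation
`Σ_j ε_j d_j = 0` among the difference vectors kills the relation form, `Σ_j ε_j d_jᵀ M m_j = 0`, then
the `k` tie equations `d_jᵀ M (y − m_j) = 0` have a common solution (Fredholm alternative: a functional
`ε` killing the range of `y ↦ (d_jᵀ M y)_j` has `(Σ_j ε_j d_j)ᵀ M = 0`, so `Σ_j ε_j d_j = 0`). [folklore] -/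
theorem exists_ties_of_forall_relForm_eq_zero (M : Matrix (Fin g) (Fin g) ℝ) (hM : M.det ≠ 0)
    (d m : Fin k → Fin g → ℝ)
    (h : ∀ ε : Fin k → ℝ, ∑ j, ε j • d j = 0 → ∑ j, ε j * (d j ⬝ᵥ M *ᵥ m j) = 0) :
    ∃ y : Fin g → ℝ, ∀ j, d j ⬝ᵥ M *ᵥ (y - m j) = 0 := by
  classical
  let T : (Fin g → ℝ) →ₗ[ℝ] (Fin k → ℝ) :=
    { toFun := fun y j => d j ⬝ᵥ M *ᵥ y
      map_add' := fun y y' => by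
        funext j; simp only [Matrix.mulVec_add, dotProduct_add, Pi.add_apply]
      map_smul' := fun c y => by
        funext j
        simp only [Matrix.mulVec_smul, dotProduct_smul, smul_eq_mul, Pi.smul_apply, RingHom.id_apply] }
  let b : Fin k → ℝ := fun j => d j ⬝ᵥ M *ᵥ m j
  have hb : b ∈ LinearMap.range T := by
    rw [← Subspace.forall_mem_dualAnnihilator_apply_eq_zero_iff]
    intro φ hφ
    rw [Submodule.mem_dualAnnihilator] at hφ
    let ε : Fin k → ℝ := fun j => φ (fun i => if j = i then 1 else 0)
    have hφv : ∀ v : Fin k → ℝ, φ v = ∑ j, ε j * v j := by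
      intro v
      rw [LinearMap.pi_apply_eq_sum_univ φ v]
      exact Finset.sum_congr rfl fun j _ => by rw [smul_eq_mul, mul_comm]
    have hkill : ∀ y : Fin g → ℝ, ∑ j, ε j * (d j ⬝ᵥ M *ᵥ y) = 0 := by
      intro y
      have hy : φ (T y) = 0 := hφ _ (LinearMap.mem_range_self T y)
      rw [hφv] at hy
      exact hy
    have hrel : ∑ j, ε j • d j = 0 := by
      have hvm : (∑ j, ε j • d j) ᵥ* M = 0 := by
        refine dotProduct_eq_zero _ (fun w => ?_)
        rw [← Matrix.dotProduct_mulVec, sum_dotProduct]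
        have := hkill w
        rw [← this]
        exact Finset.sum_congr rfl fun j _ => by rw [smul_dotProduct, smul_eq_mul]
      exact Matrix.eq_zero_of_vecMul_eq_zero hM hvm
    rw [hφv]
    have := h ε hrel
    simpa only [b] using this
  obtain ⟨y, hy⟩ := hb
  refine ⟨y, fun j => ?_⟩
  have hj : d j ⬝ᵥ M *ᵥ y = d j ⬝ᵥ M *ᵥ m j := by
    have := congrFun hy j
    simpa only [T, b, LinearMap.coe_mk, AddHom.coe_mk] using this
  rw [Matrix.mulVec_sub, dotProduct_sub, hj, sub_self]

/-- **The persistence criterion as an `iff` (any non-degenerate matrix).** The tie equations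
`d_jᵀ M (y − m_j) = 0` have a common solution iff every relation among the `d_j` kills the relation
form `Σ_j ε_j d_jᵀ M m_j`. [folklore] -/
theorem exists_ties_iff_forall_relForm_eq_zero (M : Matrix (Fin g) (Fin g) ℝ) (hM : M.det ≠ 0)
    (d m : Fin k → Fin g → ℝ) :
    (∃ y : Fin g → ℝ, ∀ j, d j ⬝ᵥ M *ᵥ (y - m j) = 0) ↔
      ∀ ε : Fin k → ℝ, ∑ j, ε j • d j = 0 → ∑ j, ε j * (d j ⬝ᵥ M *ᵥ m j) = 0 :=
  ⟨fun ⟨y, hy⟩ ε hε => relForm_eq_zero_of_ties M d m ε hε y hy,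
    exists_ties_of_forall_relForm_eq_zero M hM d m⟩

variable {n : ℕ}

/-- **Generic excess structures are formally realisable at every period of the family.** If a tie
structure with rational coset data (`d_j, m_j ∈ ℚ²ⁿ`) is realised by a point at a VERY GENERAL Weil
period `Q`, then at every positive definite symmetric `J`-commuting `P` — the split point `A ⊕ A`, the
product periods, any other member — its tie equations `d_jᵀ P (y′ − m_j) = 0` again have a common
solution `y′`. (Fredholm criterion at `P`; a real relation `ε` equals `(1 − GN)ε` for a rational
generalized inverse `G` of `N = (d_{j,a})`, a real combination of the rational relations in the columns
of `1 − GN`, whose forms vanish by `relForm_eq_zero_of_isWeilGeneric`.) The nearest-point inequalities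
at `P` are NOT claimed — they are what a census at the degenerate period checks.
[cite: Zharkov2020TropicalWeil, §2 (pp. 2–4)] -/
theorem exists_ties_of_isWeilGeneric {Q : Matrix (Fin (2 * n)) (Fin (2 * n)) ℝ}
    (hQ : Q.PosDef) (hQJ : Q * weilJ n = weilJ n * Q) (hgen : IsWeilGeneric n Q)
    (d m : Fin k → Fin (2 * n) → ℚ) (y : Fin (2 * n) → ℝ)
    (htie : ∀ j, (fun a => (d j a : ℝ)) ⬝ᵥ Q *ᵥ (y - fun a => (m j a : ℝ)) = 0)
    (P : Matrix (Fin (2 * n)) (Fin (2 * n)) ℝ) (hP : P.PosDef) (hJ : P * weilJ n = weilJ n * P) :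
    ∃ y' : Fin (2 * n) → ℝ, ∀ j, (fun a => (d j a : ℝ)) ⬝ᵥ P *ᵥ (y' - fun a => (m j a : ℝ)) = 0 := by
  classical
  have hPS : P.IsSymm := by
    have h := hP.1
    rw [Matrix.IsHermitian, Matrix.conjTranspose_eq_transpose_of_trivial] at h
    exact h
  refine exists_ties_of_forall_relForm_eq_zero P hP.det_pos.ne' _ _ (fun ε hε => ?_)
  let N : Matrix (Fin (2 * n)) (Fin k) ℚ := Matrix.of fun a j => d j a
  obtain ⟨G, hG⟩ := FormalCycleCriterion.exists_generalizedInverse N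
  let R : Matrix (Fin k) (Fin k) ℚ := 1 - G * N
  -- (i) the columns of `R` are rational relations among the `d_j`; (ii) `ε = R ε` as `N ε = 0`
  have hNR : N * R = 0 := by
    simp only [R, Matrix.mul_sub, Matrix.mul_one, ← Matrix.mul_assoc, hG, sub_self]
  have hr : ∀ i : Fin k, ∑ j, R j i • d j = 0 := by
    intro i; funext a
    have e := congrFun (congrFun hNR a) i
    rw [Matrix.mul_apply, Matrix.zero_apply] at e
    simp only [Finset.sum_apply, Pi.smul_apply, smul_eq_mul, Pi.zero_apply]
    rw [← e]
    exact Finset.sum_congr rfl fun j _ => by exact mul_comm _ _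
  have hNε : ∀ a, ∑ i, (N a i : ℝ) * ε i = 0 := by
    intro a
    have e := congrFun hε a
    simp only [Finset.sum_apply, Pi.smul_apply, smul_eq_mul, Pi.zero_apply] at e
    rw [← e]
    exact Finset.sum_congr rfl fun i _ => by exact mul_comm _ _
  have hRε : ∀ j, ε j = ∑ i, (R j i : ℝ) * ε i := by
    intro j
    have e1 : ∑ i, (R j i : ℝ) * ε i = ε j - ∑ i, ((G * N) j i : ℝ) * ε i := by
      simp only [R, Matrix.sub_apply, Matrix.one_apply, Rat.cast_sub, sub_mul,
        Finset.sum_sub_distrib]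
      congr 1
      rw [Finset.sum_eq_single j]
      · simp
      · intro i _ hij; simp [Ne.symm hij]
      · intro h; exact absurd (Finset.mem_univ j) h
    have e2 : ∑ i, ((G * N) j i : ℝ) * ε i = 0 := by
      have step : ∀ i, ((G * N) j i : ℝ) * ε i = ∑ a, (G j a : ℝ) * ((N a i : ℝ) * ε i) := by
        intro i
        rw [Matrix.mul_apply, Rat.cast_sum, Finset.sum_mul]
        exact Finset.sum_congr rfl fun a _ => by rw [Rat.cast_mul, mul_assoc]
      simp_rw [step]
      rw [Finset.sum_comm]
      refine Finset.sum_eq_zero fun a _ => ?_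
      rw [← Finset.mul_sum, hNε a, mul_zero]
    rw [e1, e2, sub_zero]
  have hmain : ∀ i, ∑ j, ((R j i : ℚ) : ℝ) *
      ((fun a => (d j a : ℝ)) ⬝ᵥ P *ᵥ fun a => (m j a : ℝ)) = 0 :=
    fun i => relForm_eq_zero_of_isWeilGeneric hQ hQJ hgen d m (fun j => R j i) (hr i) y htie P hPS hJ
  have expand : ∀ j, ε j * ((fun a => (d j a : ℝ)) ⬝ᵥ P *ᵥ fun a => (m j a : ℝ)) =
      ∑ i, ε i * ((R j i : ℝ) * ((fun a => (d j a : ℝ)) ⬝ᵥ P *ᵥ fun a => (m j a : ℝ))) := by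
    intro j
    rw [hRε j, Finset.sum_mul]
    exact Finset.sum_congr rfl fun i _ => by ring
  simp_rw [expand]
  rw [Finset.sum_comm]
  refine Finset.sum_eq_zero fun i _ => ?_
  rw [← Finset.mul_sum, hmain i, mul_zero]

end Converse

end Summit.HodgeConjecture.HodgeConjecture.Theorems.TropicalWeilVanishing.GenericTies

end
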